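import Mathlib
import Summits.CriticalPhenomena.CardyFormulaZ2.Theorems.CardySelfRefinementGradientComparabilityKernelsBulk
import Summits.CriticalPhenomena.CardyFormulaZ2.Theorems.CardySelfRefinementGradientComparabilityDivergesAtZeroHalf
import HarnessLib

/-!
# `GradientComparability`, line `Sketch`: the crux REDUCED to its four research kernels

Route `CardySelfRefinement`, sub-problem `CriticalPhenomena/CardyFormulaZ2`; crux `GradientComparability`
(stmt-CriticalPhenomena-10269), line `Sketch` (card `Ideas/level-curve-window-transport.md`).
Vocabulary (`M A P Dρ Dc PathOK`, `Aloc`, …) from `CardySelfRefinementDefs` (definitionally the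
route's `let`-chain).  The crux: for `k ∈ {2,3}`, every RSW path `γ : (1,0) → (0,½)` of the
self-refinement model `M_k(ρ,c)` and every nonempty finite quad family `F`, the Russo-gradient size
`G(η,q) = |∂ρP| + |∂cP|` is (i) comparable up to one constant between any two path points at equal
small mesh and (ii) tends to `+∞` uniformly along the path.

These `…Kernels*` files are the KERNEL-CHECKED REDUCTION of the crux to the four OPEN registered
stubs of the line (its research kernels), taken as section hypotheses with the stubs' literal
signatures: BET = `stub_transversalSlopeLipschitz` (`hBET`), W = `stub_Dc_windowStability` (`hW`),
R = `stub_Drho_le_window` (`hR`), CORNER = `stub_cornerTwoCharts` (`hCorner`); every other input of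
the line is PROVED in the tree and imported.

## This file (3/3): corner chart, clause (i), and the reduction theorem

* `cornerComparability` — CORNER's two sub-charts overlap on an interval the path visits (IVT);
* `comparability` — bulk (file 2/3) and corner charts overlap on `ρ ∈ [1−2δ, 1−δ]` (IVT): clause (i);
* `gradientComparability_of_kernels : BET → W → R → CORNER → GradientComparability` — clause (ii)
  from clause (i) and the PROVED divergence at the Bernoulli endpoint `s = 1 ↦ (0,½)`
  (`divergesAt_zero_half`).  When the four kernels are proved, the line closes the crux by
  `gradientComparability_of_kernels stub_transversalSlopeLipschitz stub_Dc_windowStability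
  stub_Drho_le_window stub_cornerTwoCharts`.
-/

noncomputable section

namespace Summit.CriticalPhenomena.CardyFormulaZ2.Theorems.CardySelfRefinement

open scoped Topology
open Filter Set MeasureTheory
open Literature.Probability.LatticeModels Literature.Probability.Percolation
open Literature.Probability.Percolation.QuadCrossing
open Summit.CriticalPhenomena.CardyFormulaZ2.Theses.CardySelfRefinement

/- (hypothesis `hBET`, registered stub `stub_transversalSlopeLipschitz`)  **THE BET — transversal slope bound (`TransversalSlopeLipschitz`; open, = the route's rank-2
rate `θ₀ > 2 − α₄`).**  In the bulk `ρ ≤ 1 − δ` and for two fixed levels `0 < vlo < vhi < 1`, the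
slope field `R = ∂ρP/∂cP` of the crossing polynomial `P_η` is Lipschitz in `c` ACROSS THE BAND
`{vlo ≤ P_η(ρ,·) ≤ vhi}` with a MESH-UNIFORM constant `Θ`.  (Each of `∂c log ∂ρP`, `∂c log ∂cP` is of
window size `≍ η⁻²π₄`; the bet is that their difference is `O(1)` — a second-order seed-forgetting
cancellation inside ONE model; MC j005815 at `ρ = 0`: relative spread of `R` across the window
`0.465 → 0.312 → 0.227` at `L = 64 → 256`, `∂c log R` between bounded and `∝ 1/W`, undecided.)
Falsifiable: a measured `∂c log R ∝ 1/W(L)` kills it (and TrivialSectorRate's mechanism at `ρ = 0`). -/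
variable (hBET :
    ∀ k : ℕ, k = 2 ∨ k = 3 → ∀ γ : unitInterval → ℝ × ℝ, PathOK k γ →
      ∀ (m : ℕ) (F : Fin m → Quad (Set.univ : Set ℂ)), 0 < m → ∀ δ : ℝ, 0 < δ → δ ≤ 1 / 2 →
        ∀ vlo vhi : ℝ, 0 < vlo → vlo < vhi → vhi < 1 →
          ∃ Θ η₁ : ℝ, 0 ≤ Θ ∧ 0 < η₁ ∧ ∀ η ∈ Set.Ioo 0 η₁, ∀ ρ ∈ Set.Icc (0 : ℝ) (1 - δ),
            ∀ c ∈ Set.Icc (0 : ℝ) 1, ∀ c' ∈ Set.Icc (0 : ℝ) 1,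
              P k m F η ρ c ∈ Set.Icc vlo vhi → P k m F η ρ c' ∈ Set.Icc vlo vhi →
                |Dρ k m F η (ρ, c) / Dc k m F η (ρ, c) - Dρ k m F η (ρ, c') / Dc k m F η (ρ, c')| ≤
                  Θ * |c - c'|)

/- (hypothesis `hW`, registered stub `stub_Dc_windowStability`)  **(W) KESTEN'S WINDOW STABILITY FOR `M_k` (open research kernel, canonical form).**  In the
bulk `ρ ≤ 1 − δ` and for two fixed levels `0 < vlo < vhi < 1`: across the finite-size critical
window `{c ∈ [0,1] : P_η(ρ,c) ∈ [vlo, vhi]}` the Russo derivative `∂cP = Σ_{non-axial e} P(e pivotal)`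
varies by at most a MESH-UNIFORM factor `Λ₂` (Kesten 1987, Thm 1/§5 for Bernoulli percolation:
four-arm counts are stable inside the near-critical window; for the 1-dependent `M_k(ρ,·)`, a
monotone Bernoulli family in the independent non-axial coins over the FKG block environment, not
in print; nearest tree fact `Literature.Probability.Percolation.Kesten1987_zdKestenRelation`,
bond-`ℤ²`, unproved). -/
variable (hW :
    ∀ k : ℕ, k = 2 ∨ k = 3 → ∀ γ : unitInterval → ℝ × ℝ, PathOK k γ →
      ∀ (m : ℕ) (F : Fin m → Quad (Set.univ : Set ℂ)), 0 < m → ∀ δ : ℝ, 0 < δ → δ ≤ 1 / 2 →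
        ∀ vlo vhi : ℝ, 0 < vlo → vlo < vhi → vhi < 1 →
          ∃ Λ₂ η₂ : ℝ, 0 < Λ₂ ∧ 0 < η₂ ∧ ∀ η ∈ Set.Ioo 0 η₂, ∀ ρ ∈ Set.Icc (0 : ℝ) (1 - δ),
            ∀ c ∈ Set.Icc (0 : ℝ) 1, ∀ c' ∈ Set.Icc (0 : ℝ) 1,
              P k m F η ρ c ∈ Set.Icc vlo vhi → P k m F η ρ c' ∈ Set.Icc vlo vhi →
                Dc k m F η (ρ, c) ≤ Λ₂ * Dc k m F η (ρ, c'))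

/- (hypothesis `hR`, registered stub `stub_Drho_le_window`)  **(R) THE `ρ`-DERIVATIVE IS AT MOST WINDOW SIZE (open research kernel).**  In the bulk and for
level selections `cm < cp` of `P_η(ρ,·)` at two fixed levels: at the path points,
`|∂ρP(γ s)| · (cp − cm)(ρ_s) ≤ Λ₃` mesh-uniformly (`∂ρP = ¼Σ_blocks E[Δ₁Δ₂ 1_A]` (k = 2) is a
signed sum of block second differences, each bounded by block-pivotality; block-pivotal counts are
four-arm counts `≍` window⁻¹ by Kesten's relation — for `M_k` not in print). -/
variable (hR :
    ∀ k : ℕ, k = 2 ∨ k = 3 → ∀ γ : unitInterval → ℝ × ℝ, PathOK k γ →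
      ∀ (m : ℕ) (F : Fin m → Quad (Set.univ : Set ℂ)), 0 < m → ∀ δ : ℝ, 0 < δ → δ ≤ 1 / 2 →
        ∀ vlo vhi : ℝ, 0 < vlo → vlo < vhi → vhi < 1 →
          ∃ Λ₃ η₃ : ℝ, 0 < Λ₃ ∧ 0 < η₃ ∧ ∀ η ∈ Set.Ioo 0 η₃, ∀ cm cp : ℝ → ℝ,
            (∀ ρ ∈ Set.Icc (0 : ℝ) (1 - δ), cm ρ ∈ Set.Icc (0 : ℝ) 1 ∧ cp ρ ∈ Set.Icc (0 : ℝ) 1 ∧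
                P k m F η ρ (cm ρ) = vlo ∧ P k m F η ρ (cp ρ) = vhi) →
            ∀ s : unitInterval, (γ s).1 ≤ 1 - δ →
              |Dρ k m F η (γ s)| * (cp (γ s).1 - cm (γ s).1) ≤ Λ₃)

/- (hypothesis `hCorner`, registered stub `stub_cornerTwoCharts`)  **CORNER CHARTS (open; reshaped in cycle 1 after the corner worker's typing analysis).**  The
honest content of the corner chart near the endpoint `(1,0)`: a mesh-dependent width `w(η) → 0⁺`
(intended: a constant times the Kesten window `1 / G(η,(1,0))` of the endpoint model `M_k(1,0)` =
bond-`ℤ²` at mesh `kη`, `selfRefinementMeasure_one_zero`) and two sub-charts sharing it: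
* TIP (Kesten box of `M_k(1,0)`): for EVERY aperture `a > 0`, comparability of the gradient size on
  `{s | 1 − a·w(η) ≤ ρ_s}` (Kesten stability of `|∂ρP| + |∂cP|` inside the near-critical window of
  `M_k` around `(1,0)`, non-monotone direction `ρ`, monotone direction `c`; path points there have
  `c_s ≲ w^{1/k}` by pinning to the critical curve);
* `c`-CHART: for SOME aperture `a > 0` and depth `δ ∈ (0,½]`, comparability on
  `{s | 1 − 2δ ≤ ρ_s ≤ 1 − a·w(η)}` (level curves of `P_η` as graphs `ρ±(c)`, horizontal Kesten
  dictionary `G ≍ 1/(ρ₊ − ρ₋)`, and the transversal slope bound `|∂ρ(∂cP/∂ρP)| ≤ Θ'` on the band,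
  mesh-uniform — the same bet as in the bulk chart; its Grönwall step is again
  `stub_levelGapTransport`, landed).
Research-level: Kesten's near-critical theory for the 1-dependent `M_k` is not in print; nearest tree
fact `Literature.Probability.Percolation.Kesten1987_zdKestenRelation` (bond-`ℤ²`, unproved). -/
variable (hCorner :
    ∀ k : ℕ, k = 2 ∨ k = 3 → ∀ γ : unitInterval → ℝ × ℝ, PathOK k γ →
      ∀ (m : ℕ) (F : Fin m → Quad (Set.univ : Set ℂ)), 0 < m →
        ∃ w : ℝ → ℝ, Tendsto w (𝓝[>] 0) (𝓝 0) ∧ (∀ η : ℝ, 0 < η → 0 < w η) ∧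
          (∀ a : ℝ, 0 < a → ∃ Λ₃ η₃ : ℝ, 0 < η₃ ∧ ∀ η ∈ Set.Ioo 0 η₃, ∀ s s' : unitInterval,
            1 - a * w η ≤ (γ s).1 → 1 - a * w η ≤ (γ s').1 →
              |Dρ k m F η (γ s)| + |Dc k m F η (γ s)| ≤
                Λ₃ * (|Dρ k m F η (γ s')| + |Dc k m F η (γ s')|)) ∧
          (∃ a δ : ℝ, 0 < a ∧ 0 < δ ∧ δ ≤ 1 / 2 ∧ ∃ Λ₄ η₄ : ℝ, 0 < η₄ ∧
            ∀ η ∈ Set.Ioo 0 η₄, ∀ s s' : unitInterval,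
              1 - 2 * δ ≤ (γ s).1 → (γ s).1 ≤ 1 - a * w η →
              1 - 2 * δ ≤ (γ s').1 → (γ s').1 ≤ 1 - a * w η →
                |Dρ k m F η (γ s)| + |Dc k m F η (γ s)| ≤
                  Λ₄ * (|Dρ k m F η (γ s')| + |Dc k m F η (γ s')|)))

-- adapted from the corner worker's scratch file work/stubs/StubCornerComparability.lean (cycle 1)
include hCorner in
/-- **Corner chart (proved composition): tip ⨉ `c`-chart ⟹ comparability on `{1 − 2δ ≤ ρ_s}` for
SOME `δ ∈ (0,½]`.**  The two sub-charts overlap on `ρ ∈ [1 − 2a·w(η), 1 − a·w(η)]`, an interval of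
positive length which the continuous path `(1,0) → (0,½)` visits (IVT at `1 − (3a/2)·w(η)`), for
every mesh small enough that `a·w(η) < δ`; so one constant serves on the whole corner region,
uniformly in `η`. -/
theorem cornerComparability :
    ∀ k : ℕ, k = 2 ∨ k = 3 → ∀ γ : unitInterval → ℝ × ℝ, PathOK k γ →
      ∀ (m : ℕ) (F : Fin m → Quad (Set.univ : Set ℂ)), 0 < m →
        ∃ δ : ℝ, 0 < δ ∧ δ ≤ 1 / 2 ∧ ∃ Λ₂ η₂ : ℝ, 0 < η₂ ∧
          ∀ s s' : unitInterval, 1 - 2 * δ ≤ (γ s).1 → 1 - 2 * δ ≤ (γ s').1 →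
            ∀ η ∈ Set.Ioo 0 η₂,
              |Dρ k m F η (γ s)| + |Dc k m F η (γ s)| ≤
                Λ₂ * (|Dρ k m F η (γ s')| + |Dc k m F η (γ s')|) := by
  intro k hk γ hγ m F hm
  obtain ⟨w, hw0, hwpos, htip, a, δ, ha, hδ, hδ', Λ₄, η₄, hη₄, hcc⟩ :=
    hCorner k hk γ hγ m F hm
  obtain ⟨Λ₃, η₃, hη₃, ht⟩ := htip (2 * a) (by positivity)
  -- meshes with `a · w η < δ`
  obtain ⟨η₅, hη₅, hsmall⟩ : ∃ η₅ : ℝ, 0 < η₅ ∧ ∀ η ∈ Set.Ioo 0 η₅, a * w η < δ := by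
    have h1 : ∀ᶠ η in 𝓝[>] (0 : ℝ), w η < δ / a :=
      hw0 (Iio_mem_nhds (div_pos hδ ha))
    rw [Filter.Eventually, mem_nhdsGT_iff_exists_Ioo_subset] at h1
    obtain ⟨η₅, hη₅, hsub⟩ := h1
    refine ⟨η₅, hη₅, fun η hη => ?_⟩
    have : w η < δ / a := hsub hη
    rwa [lt_div_iff₀ ha, mul_comm] at this
  have hcont : Continuous fun s : unitInterval => (γ s).1 := continuous_fst.comp hγ.1
  have h0 : (γ 0).1 = 1 := by rw [hγ.2.1]
  have h1 : (γ 1).1 = 0 := by rw [hγ.2.2.1]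
  set L₃ := max Λ₃ 1 with hL₃
  set L₄ := max Λ₄ 1 with hL₄
  have hL₃1 : 1 ≤ L₃ := le_max_right _ _
  have hL₄1 : 1 ≤ L₄ := le_max_right _ _
  refine ⟨δ, hδ, hδ', L₃ * L₄, min (min η₃ η₄) η₅, lt_min (lt_min hη₃ hη₄) hη₅,
    fun s s' hs hs' η hη => ?_⟩
  have hη3 : η ∈ Set.Ioo 0 η₃ :=
    ⟨hη.1, lt_of_lt_of_le hη.2 ((min_le_left _ _).trans (min_le_left _ _))⟩
  have hη4 : η ∈ Set.Ioo 0 η₄ :=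
    ⟨hη.1, lt_of_lt_of_le hη.2 ((min_le_left _ _).trans (min_le_right _ _))⟩
  have hη5 : η ∈ Set.Ioo 0 η₅ := ⟨hη.1, lt_of_lt_of_le hη.2 (min_le_right _ _)⟩
  have haw : a * w η < δ := hsmall η hη5
  have hwη : 0 < w η := hwpos η hη.1
  have haw0 : 0 < a * w η := mul_pos ha hwη
  -- the split point `ρ⋆ = 1 − (3a/2)·w η`, visited by the path
  have hmem : (1 - 3 / 2 * (a * w η) : ℝ) ∈ Set.Icc ((fun s : unitInterval => (γ s).1) 1)
      ((fun s : unitInterval => (γ s).1) 0) := by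
    simp only [h0, h1]
    constructor <;> nlinarith
  obtain ⟨sstar, -, hsstar⟩ := intermediate_value_Icc' zero_le_one hcont.continuousOn hmem
  simp only at hsstar
  have hstar_tip : 1 - 2 * a * w η ≤ (γ sstar).1 := by rw [hsstar]; nlinarith
  have hstar_lo : 1 - 2 * δ ≤ (γ sstar).1 := by rw [hsstar]; nlinarith
  have hstar_hi : (γ sstar).1 ≤ 1 - a * w η := by rw [hsstar]; nlinarith
  set Gs := |Dρ k m F η (γ s)| + |Dc k m F η (γ s)| with hGs
  set Gs' := |Dρ k m F η (γ s')| + |Dc k m F η (γ s')| with hGs'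
  set Gst := |Dρ k m F η (γ sstar)| + |Dc k m F η (γ sstar)| with hGst
  have hGs_nn : 0 ≤ Gs := by positivity
  have hGs'_nn : 0 ≤ Gs' := by positivity
  have hGst_nn : 0 ≤ Gst := by positivity
  -- the two charts with constants `≥ 1`
  have tip : ∀ b b' : unitInterval, 1 - 2 * a * w η ≤ (γ b).1 → 1 - 2 * a * w η ≤ (γ b').1 →
      |Dρ k m F η (γ b)| + |Dc k m F η (γ b)| ≤
        L₃ * (|Dρ k m F η (γ b')| + |Dc k m F η (γ b')|) := by
    intro b b' hb hb'
    have hb1 : 1 - 2 * a * w η ≤ (γ b).1 := hb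
    have hb1' : 1 - 2 * a * w η ≤ (γ b').1 := hb'
    have := ht η hη3 b b' (by linarith) (by linarith)
    have hnn : 0 ≤ |Dρ k m F η (γ b')| + |Dc k m F η (γ b')| := by positivity
    calc _ ≤ Λ₃ * (|Dρ k m F η (γ b')| + |Dc k m F η (γ b')|) := this
      _ ≤ L₃ * (|Dρ k m F η (γ b')| + |Dc k m F η (γ b')|) := by gcongr; exact le_max_left _ _
  have cch : ∀ b b' : unitInterval, 1 - 2 * δ ≤ (γ b).1 → (γ b).1 ≤ 1 - a * w η →
      1 - 2 * δ ≤ (γ b').1 → (γ b').1 ≤ 1 - a * w η →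
      |Dρ k m F η (γ b)| + |Dc k m F η (γ b)| ≤
        L₄ * (|Dρ k m F η (γ b')| + |Dc k m F η (γ b')|) := by
    intro b b' hb hb2 hb' hb2'
    have := hcc η hη4 b b' hb hb2 hb' hb2'
    have hnn : 0 ≤ |Dρ k m F η (γ b')| + |Dc k m F η (γ b')| := by positivity
    calc _ ≤ Λ₄ * (|Dρ k m F η (γ b')| + |Dc k m F η (γ b')|) := this
      _ ≤ L₄ * (|Dρ k m F η (γ b')| + |Dc k m F η (γ b')|) := by gcongr; exact le_max_left _ _
  -- every corner-region parameter lies in (at least) one sub-chart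
  have hchart : ∀ b : unitInterval, (γ b).1 ≤ 1 - a * w η ∨ 1 - 2 * a * w η ≤ (γ b).1 := by
    intro b
    by_cases hb : (γ b).1 ≤ 1 - a * w η
    · exact Or.inl hb
    · exact Or.inr (by rw [not_le] at hb; nlinarith)
  have hL₃0 : 0 ≤ L₃ := le_trans zero_le_one hL₃1
  have hL₄0 : 0 ≤ L₄ := le_trans zero_le_one hL₄1
  rcases hchart s with h1s | h1s <;> rcases hchart s' with h1s' | h1s'
  · calc Gs ≤ L₄ * Gs' := cch s s' hs h1s hs' h1s'
      _ = 1 * L₄ * Gs' := by ring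
      _ ≤ L₃ * L₄ * Gs' := by gcongr
  · calc Gs ≤ L₄ * Gst := cch s sstar hs h1s hstar_lo hstar_hi
      _ ≤ L₄ * (L₃ * Gs') := by gcongr; exact tip sstar s' hstar_tip h1s'
      _ = L₃ * L₄ * Gs' := by ring
  · calc Gs ≤ L₃ * Gst := tip s sstar h1s hstar_tip
      _ ≤ L₃ * (L₄ * Gs') := by gcongr; exact cch sstar s' hstar_lo hstar_hi hs' h1s'
      _ = L₃ * L₄ * Gs' := by ring
  · calc Gs ≤ L₃ * Gs' := tip s s' h1s h1s'
      _ = L₃ * 1 * Gs' := by ring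
      _ ≤ L₃ * L₄ * Gs' := by gcongr

/-! ## Clause (i) and the reduction theorem -/

include hBET hW hR hCorner in
/-- Clause (i): bulk and corner charts overlap on `ρ ∈ [1−2δ, 1−δ]`, which the continuous path
`(1,0) → (0,½)` visits (intermediate value theorem), so one global constant results. -/
theorem comparability {k : ℕ} (hk : k = 2 ∨ k = 3) {γ : unitInterval → ℝ × ℝ} (hγ : PathOK k γ)
    {m : ℕ} (F : Fin m → Quad (Set.univ : Set ℂ)) (hm : 0 < m) :
    ∃ Λ η₀ : ℝ, 0 < Λ ∧ 0 < η₀ ∧ ∀ s s' : unitInterval, ∀ η ∈ Set.Ioo 0 η₀,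
      |Dρ k m F η (γ s)| + |Dc k m F η (γ s)| ≤ Λ * (|Dρ k m F η (γ s')| + |Dc k m F η (γ s')|) := by
  obtain ⟨δ, hδ, hδ', Λ₂, η₂, hη₂, hcorner⟩ := cornerComparability hCorner k hk γ hγ m F hm
  obtain ⟨Λ₁, η₁, hη₁, hbulk⟩ := bulkComparability hBET hW hR hk hγ F hm hδ hδ'
  -- an overlap point `s⋆` with `ρ_{s⋆} = 1 − 3δ/2`
  have hcont : Continuous fun s : unitInterval => (γ s).1 := continuous_fst.comp hγ.1
  have h0 : (γ 0).1 = 1 := by rw [hγ.2.1]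
  have h1 : (γ 1).1 = 0 := by rw [hγ.2.2.1]
  have hmem : (1 - 3 / 2 * δ : ℝ) ∈ Set.Icc ((fun s : unitInterval => (γ s).1) 1)
      ((fun s : unitInterval => (γ s).1) 0) := by
    simp only [h0, h1]
    constructor <;> nlinarith
  obtain ⟨sstar, -, hsstar⟩ := intermediate_value_Icc' zero_le_one hcont.continuousOn hmem
  simp only at hsstar
  have hstar_bulk : (γ sstar).1 ≤ 1 - δ := by rw [hsstar]; nlinarith
  have hstar_corner : 1 - 2 * δ ≤ (γ sstar).1 := by rw [hsstar]; nlinarith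
  -- constants
  set L₁ := max Λ₁ 1 with hL₁
  set L₂ := max Λ₂ 1 with hL₂
  have hL₁1 : 1 ≤ L₁ := le_max_right _ _
  have hL₂1 : 1 ≤ L₂ := le_max_right _ _
  refine ⟨L₁ * L₂, min η₁ η₂, by positivity, lt_min hη₁ hη₂, fun s s' η hη => ?_⟩
  have hη1 : η ∈ Set.Ioo 0 η₁ := ⟨hη.1, lt_of_lt_of_le hη.2 (min_le_left _ _)⟩
  have hη2 : η ∈ Set.Ioo 0 η₂ := ⟨hη.1, lt_of_lt_of_le hη.2 (min_le_right _ _)⟩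
  set Gs := |Dρ k m F η (γ s)| + |Dc k m F η (γ s)| with hGs
  set Gs' := |Dρ k m F η (γ s')| + |Dc k m F η (γ s')| with hGs'
  set Gst := |Dρ k m F η (γ sstar)| + |Dc k m F η (γ sstar)| with hGst
  have hGs_nn : 0 ≤ Gs := by positivity
  have hGs'_nn : 0 ≤ Gs' := by positivity
  have hGst_nn : 0 ≤ Gst := by positivity
  -- upgraded chart inequalities with the constants `L₁, L₂ ≥ 1`
  have bulk : ∀ a b : unitInterval, (γ a).1 ≤ 1 - δ → (γ b).1 ≤ 1 - δ →
      |Dρ k m F η (γ a)| + |Dc k m F η (γ a)| ≤ L₁ * (|Dρ k m F η (γ b)| + |Dc k m F η (γ b)|) := by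
    intro a b ha hb
    have := hbulk a b ha hb η hη1
    have hnn : 0 ≤ |Dρ k m F η (γ b)| + |Dc k m F η (γ b)| := by positivity
    calc _ ≤ Λ₁ * (|Dρ k m F η (γ b)| + |Dc k m F η (γ b)|) := this
      _ ≤ L₁ * (|Dρ k m F η (γ b)| + |Dc k m F η (γ b)|) := by gcongr; exact le_max_left _ _
  have corner : ∀ a b : unitInterval, 1 - 2 * δ ≤ (γ a).1 → 1 - 2 * δ ≤ (γ b).1 →
      |Dρ k m F η (γ a)| + |Dc k m F η (γ a)| ≤ L₂ * (|Dρ k m F η (γ b)| + |Dc k m F η (γ b)|) := by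
    intro a b ha hb
    have := hcorner a b ha hb η hη2
    have hnn : 0 ≤ |Dρ k m F η (γ b)| + |Dc k m F η (γ b)| := by positivity
    calc _ ≤ Λ₂ * (|Dρ k m F η (γ b)| + |Dc k m F η (γ b)|) := this
      _ ≤ L₂ * (|Dρ k m F η (γ b)| + |Dc k m F η (γ b)|) := by gcongr; exact le_max_left _ _
  -- every parameter lies in (at least) one chart
  have hchart : ∀ a : unitInterval, (γ a).1 ≤ 1 - δ ∨ 1 - 2 * δ ≤ (γ a).1 := by
    intro a
    by_cases h : (γ a).1 ≤ 1 - δ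
    · exact Or.inl h
    · exact Or.inr (by rw [not_le] at h; nlinarith)
  rcases hchart s with hs | hs <;> rcases hchart s' with hs' | hs'
  · have hL₁0 : 0 ≤ L₁ := le_trans zero_le_one hL₁1
    calc Gs ≤ L₁ * Gs' := bulk s s' hs hs'
      _ ≤ L₁ * L₂ * Gs' := by nlinarith [mul_nonneg (mul_nonneg hL₁0 hGs'_nn) (sub_nonneg.2 hL₂1)]
  · calc Gs ≤ L₁ * Gst := bulk s sstar hs hstar_bulk
      _ ≤ L₁ * (L₂ * Gs') := by gcongr; exact corner sstar s' hstar_corner hs'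
      _ = L₁ * L₂ * Gs' := by ring
  · calc Gs ≤ L₂ * Gst := corner s sstar hs hstar_corner
      _ ≤ L₂ * (L₁ * Gs') := by gcongr; exact bulk sstar s' hstar_bulk hs'
      _ = L₁ * L₂ * Gs' := by ring
  · have hL₂0 : 0 ≤ L₂ := le_trans zero_le_one hL₂1
    calc Gs ≤ L₂ * Gs' := corner s s' hs hs'
      _ ≤ L₁ * L₂ * Gs' := by nlinarith [mul_nonneg (mul_nonneg hL₂0 hGs'_nn) (sub_nonneg.2 hL₁1)]

include hBET hW hR hCorner in
/-- **The line `Sketch` reduces the crux to its four research kernels (kernel-checked reduction):**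
`GradientComparability` follows from THE BET (`stub_transversalSlopeLipschitz`), Kesten's window
stability for `M_k` (`stub_Dc_windowStability`), the window bound on the `ρ`-derivative
(`stub_Drho_le_window`) and the corner charts (`stub_cornerTwoCharts`) — every other input of the
line (Grönwall engine, implicit function theorem, boundary values, positivity, Russo dictionaries,
uniform non-degeneracy along the path, the bond-`ℤ²` divergence at `(0,½)`) being PROVED in the
tree.  Clause (i) from `comparability`; clause (ii) from clause (i) and `divergesAt_zero_half`. -/
theorem gradientComparability_of_kernels : GradientComparability := by
  rw [gradientComparability_iff]
  intro k hk γ hγ m F hm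
  obtain ⟨Λ, η₀, hΛ, hη₀, hcomp⟩ := comparability hBET hW hR hCorner hk hγ F hm
  refine ⟨Λ, η₀, hη₀, hcomp, fun N => ?_⟩
  obtain ⟨η₁, hη₁, hdiv⟩ := divergesAt_zero_half k hk m F hm (Λ * max N 0)
  refine ⟨min η₀ η₁, lt_min hη₀ hη₁, fun η hη s => ?_⟩
  have hη0 : η ∈ Set.Ioo 0 η₀ := ⟨hη.1, lt_of_lt_of_le hη.2 (min_le_left _ _)⟩
  have hη1 : η ∈ Set.Ioo 0 η₁ := ⟨hη.1, lt_of_lt_of_le hη.2 (min_le_right _ _)⟩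
  have hend : γ 1 = ((0 : ℝ), (1 / 2 : ℝ)) := hγ.2.2.1
  have h1 := hcomp 1 s η hη0
  rw [hend] at h1
  have h2 := hdiv η hη1
  have hGs : 0 ≤ |Dρ k m F η (γ s)| + |Dc k m F η (γ s)| := by positivity
  nlinarith [le_max_left N 0, le_max_right N 0]

end Summit.CriticalPhenomena.CardyFormulaZ2.Theorems.CardySelfRefinement

end
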